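/-
Copyright (c) 2026. All rights reserved.
Released under Apache 2.0 license as described in the file LICENSE.
-/
import Mathlib
import HarnessLib
import Literature.Topology.FourManifolds.LevelPassageUntwisted
import Literature.Topology.FourManifolds.CircleLoopDrag
import Literature.Topology.FourManifolds.CircleHomotopyIsotopy
import Literature.Topology.FourManifolds.IsotopyExtension

/-!
# Level passages from an odd level are connected sums with `S² × S²` (the drag)

Topic `Literature/Topology/FourManifolds`. Module Asm of the proof of
`Literature.Topology.FourManifolds.exists_middleLevel_isStabilization_of_isHCobordism` (Kirby 1989,
Ch. X p. 56 with Cor. I.4.6, the odd case: *"it can be arranged for all 2-handles of W to be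
attached by the trivial framing"* by dragging the attaching circle around a 2-sphere on which
`w₂ ≠ 0`).

* §1 inserted classes only see the annulus on `[0, 1]` and only its homotopy class relative to the
  end times (`eClass_insertDisc_eq_of_homotopicRel`); slowing an annulus down near its ends does
  not change the class (`eClass_insertDisc_slowA`).
* §2 `isConnectedSum_of_ob_flatDisc_eq` — the core of `isConnectedSum_of_forall_ob_eq`
  (`LevelPassageUntwisted.lean`) for ONE disc: a tube of the standard circle of a chart whose
  class relative to the flat disc is the universal class presents the surgery as `V # S² × S²`;
  `isConnectedSum_of_exists_odd` — if the level `V` contains a sphere map without stable tangent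
  framing, the class can always be made universal: the drag loop `dragLoop` (`CircleLoopDrag.lean`)
  is smoothed rel ends and perturbed into a smooth isotopy of the standard circle in its homotopy
  class (`CircleHomotopyIsotopy.lean`), extended to an ambient isotopy `Ψ` (Thm. 5.8,
  `exists_ambientIsotopy_comp_eq`), and transporting the tube by `Ψ₁⁻¹` adds the class of the drag
  loop, i.e. `1`, to the class relative to the flat disc (drag identity
  `ob_compDisc_ambientIsotopy`, `eClass_insertDisc_dragLoop_ne`).
* §3 `Cobordism.IsHCobordism.isConnectedSum_levels_of_odd` — the level passage across an
  index-2 critical point of an h-cobordism, from a level containing such a sphere map, is a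
  connected sum with `S² × S²` (Milnor's level-passing surgery `LevelPassageSurgery.lean` + §2).

Everything is proved; the only definition is the explicit reparametrisation `slowA`; no named
facts.

## References

* R. C. Kirby, *The topology of 4-manifolds*, LNM 1374 (1989), Ch. X, pp. 55–56; Cor. I.4.6.
  [Kirby1989]
* J. Milnor, *Lectures on the h-cobordism theorem* (1965), Thm. 5.8 (PDF p. 34), §3 p. 21.
  [MilnorHCobordism1965]
-/

noncomputable section

open Set Function Metric Matrix Topology Bundle Module
open scoped Topology Manifold ContDiff Real unitInterval

namespace Literature.Topology.FourManifolds

universe u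

open StableFrames GLLoop StdCircleSurgery

/-- Local notation: `𝔼 n` is the model Euclidean space `EuclideanSpace ℝ (Fin n)`. -/
local notation "𝔼 " n:arg => EuclideanSpace ℝ (Fin n)

/-- Local notation: the unit circle. -/
local notation "𝕊¹" => (sphere (0 : EuclideanSpace ℝ (Fin (1 + 1))) 1)

/-- Local notation: the closed unit disc in the plane. -/
local notation "𝔻²" => StableFrames.UnitDisc2

/-- Local notation: the unit `2`-sphere. -/
local notation "𝕊²" => (sphere (0 : EuclideanSpace ℝ (Fin (2 + 1))) 1)

namespace StableFrames

variable {m : ℕ} {M : Type*} [TopologicalSpace M] [ChartedSpace (𝔼 m) M] [IsManifold (𝓡 m) 1 M]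

/-! ### 1. Inserted classes only see the annulus on `[0, 1]`, and only its homotopy class rel ends -/

section Homotopy

omit [ChartedSpace (𝔼 m) M] [IsManifold (𝓡 m) 1 M] in
/-- **Insertion only uses the annulus at times in `[0, 1]`.** [folklore] -/
theorem insertDisc_congr_Icc {A A' : C(ℝ × 𝕊¹, M)} {X : C(𝔻², M)} (h : ∀ t ∈ Icc (0 : ℝ) 1, ∀ u, A (t, u) = A' (t, u))
    (hA : ∀ u, A (1, u) = X (bd u)) (hA' : ∀ u, A' (1, u) = X (bd u)) : insertDisc A X hA = insertDisc A' X hA' := by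
  ext x
  change insertFun A X x = insertFun A' X x
  unfold insertFun
  split_ifs with hx
  · rfl
  · push Not at hx
    have h1 : ‖(x : EuclideanSpace ℝ (Fin (1 + 1)))‖ ≤ 1 := mem_closedBall_zero_iff.mp x.2
    exact h _ ⟨by linarith, by linarith⟩ _

/-- **Annuli homotopic relative to a set containing the end times insert the same class.**
[folklore] -/
theorem eClass_insertDisc_eq_of_homotopicRel (hm : 2 ≤ m) {γ : 𝕊¹ → M} {A A' : C(ℝ × 𝕊¹, M)} {S : Set (ℝ × 𝕊¹)}
    (h : A.HomotopicRel A' S) (hS0 : ∀ u, ((0 : ℝ), u) ∈ S) (hS1 : ∀ u, ((1 : ℝ), u) ∈ S)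
    (hA0 : ∀ u, A (0, u) = γ u) (X : C(𝔻², M)) (hAX : ∀ u, A (1, u) = X (bd u)) (hA'X : ∀ u, A' (1, u) = X (bd u))
    {F : 𝕊¹ → Fr m} (hF : IsStableFrameFieldOn γ F univ) :
    eClass (insertDisc A X hAX) F (hF.congr_map fun u _ => by change insertDisc A X _ (bd u) = γ u; rw [insertDisc_bd, hA0]) =
      eClass (insertDisc A' X hA'X) F (hF.congr_map fun u _ => by
        change insertDisc A' X _ (bd u) = γ u; rw [insertDisc_bd, ← h.fst_eq_snd (hS0 u), hA0]) := by
  obtain ⟨K⟩ := h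
  set As : I → C(ℝ × 𝕊¹, M) := fun s => ⟨fun q => K (s, q), K.continuous.comp (continuous_const.prodMk continuous_id)⟩ with hAs
  have hAsc : Continuous fun p : I × (ℝ × 𝕊¹) => As p.1 p.2 := K.continuous
  have hAs0 : ∀ s u, As s (0, u) = γ u := fun s u => (K.prop' s _ (hS0 u)).trans (hA0 u)
  have hAs1 : ∀ s u, As s (1, u) = X (bd u) := fun s u => (K.prop' s _ (hS1 u)).trans (hAX u)
  have key := eClass_insertDisc_eq_of_family hm As hAsc hAs0 X hAs1 hF
  have e0 : As 0 = A := by ext q; exact K.apply_zero q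
  have e1 : As 1 = A' := by ext q; exact K.apply_one q
  have hins : ∀ (A₁ A₂ : C(ℝ × 𝕊¹, M)) (h₁ : ∀ u, A₁ (1, u) = X (bd u)) (h₂ : ∀ u, A₂ (1, u) = X (bd u)),
      A₁ = A₂ → insertDisc A₁ X h₁ = insertDisc A₂ X h₂ := by
    intros A₁ A₂ h₁ h₂ e; subst e; rfl
  rw [← eClass_congr_disc (hins _ _ (hAs1 0) hAX e0), ← eClass_congr_disc (hins _ _ (hAs1 1) hA'X e1)]
  exact key

omit [ChartedSpace (𝔼 m) M] [IsManifold (𝓡 m) 1 M] in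
/-- **The slow-down reparametrisation** `t ↦ clamp (3t - 1)` of an annulus: constant on
`t ≤ 1/3` and on `t ≥ 2/3`. [folklore] -/
def slowA (A : C(ℝ × 𝕊¹, M)) : C(ℝ × 𝕊¹, M) :=
  ⟨fun q => A (clamp01 (3 * q.1 - 1), q.2), A.continuous.comp ((continuous_clamp01.comp (by fun_prop)).prodMk continuous_snd)⟩

omit [ChartedSpace (𝔼 m) M] [IsManifold (𝓡 m) 1 M] in
/-- The slowed annulus at early times. [folklore] -/
theorem slowA_of_le (A : C(ℝ × 𝕊¹, M)) {t : ℝ} (ht : t ≤ 1 / 3) (u : 𝕊¹) : slowA A (t, u) = A (0, u) := by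
  change A (clamp01 (3 * t - 1), u) = A (0, u)
  have : clamp01 (3 * t - 1) = 0 := by
    unfold clamp01; rw [max_eq_left]; exact min_le_of_right_le (by linarith)
  rw [this]

omit [ChartedSpace (𝔼 m) M] [IsManifold (𝓡 m) 1 M] in
/-- The slowed annulus at late times. [folklore] -/
theorem slowA_of_ge (A : C(ℝ × 𝕊¹, M)) {t : ℝ} (ht : 2 / 3 ≤ t) (u : 𝕊¹) : slowA A (t, u) = A (1, u) := by
  change A (clamp01 (3 * t - 1), u) = A (1, u)
  have : clamp01 (3 * t - 1) = 1 := by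
    unfold clamp01; rw [min_eq_left (by linarith), max_eq_right zero_le_one]
  rw [this]

/-- **Slowing down does not change the inserted class** (the reparametrisations
`(1 - s) clamp(3t - 1) + s t` fix the end times). [folklore] -/
theorem eClass_insertDisc_slowA (hm : 2 ≤ m) {γ : 𝕊¹ → M} (A : C(ℝ × 𝕊¹, M)) (hA0 : ∀ u, A (0, u) = γ u)
    (X : C(𝔻², M)) (hAX : ∀ u, A (1, u) = X (bd u)) {F : 𝕊¹ → Fr m} (hF : IsStableFrameFieldOn γ F univ) :
    eClass (insertDisc (slowA A) X fun u => (slowA_of_ge A (by norm_num) u).trans (hAX u)) F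
        (hF.congr_map fun u _ => by change insertDisc (slowA A) X _ (bd u) = γ u; rw [insertDisc_bd, slowA_of_le A (by norm_num), hA0]) =
      eClass (insertDisc A X hAX) F (hF.congr_map fun u _ => by change insertDisc A X _ (bd u) = γ u; rw [insertDisc_bd, hA0]) := by
  set As : I → C(ℝ × 𝕊¹, M) := fun s => ⟨fun q => A ((1 - (s : ℝ)) * clamp01 (3 * q.1 - 1) + (s : ℝ) * q.1, q.2),
    A.continuous.comp ((((continuous_const.mul (continuous_clamp01.comp (by fun_prop))).add
      (continuous_const.mul continuous_fst))).prodMk continuous_snd)⟩ with hAs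
  have hAsc : Continuous fun p : I × (ℝ × 𝕊¹) => As p.1 p.2 := by
    refine A.continuous.comp ?_
    exact ((((continuous_const.sub (continuous_subtype_val.comp continuous_fst)).mul
      (continuous_clamp01.comp ((continuous_const.mul (continuous_fst.comp continuous_snd)).sub continuous_const))).add
      ((continuous_subtype_val.comp continuous_fst).mul (continuous_fst.comp continuous_snd))).prodMk
      (continuous_snd.comp continuous_snd))
  have hc0 : clamp01 (3 * 0 - 1) = 0 := by
    unfold clamp01; rw [max_eq_left]; exact min_le_of_right_le (by norm_num)
  have hc1 : clamp01 (3 * 1 - 1) = 1 := by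
    unfold clamp01; rw [min_eq_left (by norm_num), max_eq_right zero_le_one]
  have hAs0 : ∀ s u, As s (0, u) = γ u := fun s u => by
    change A ((1 - (s : ℝ)) * clamp01 (3 * 0 - 1) + (s : ℝ) * 0, u) = γ u
    rw [hc0, mul_zero, mul_zero, add_zero, hA0]
  have hAs1 : ∀ s u, As s (1, u) = X (bd u) := fun s u => by
    change A ((1 - (s : ℝ)) * clamp01 (3 * 1 - 1) + (s : ℝ) * 1, u) = X (bd u)
    rw [hc1, mul_one, mul_one, sub_add_cancel, hAX]
  have key := eClass_insertDisc_eq_of_family hm As hAsc hAs0 X hAs1 hF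
  have e0 : As 0 = slowA A := by
    ext q; change A ((1 - ((0 : I) : ℝ)) * clamp01 (3 * q.1 - 1) + ((0 : I) : ℝ) * q.1, q.2) = A (clamp01 (3 * q.1 - 1), q.2)
    rw [show ((0 : I) : ℝ) = 0 from rfl]; ring_nf
  have e1 : As 1 = A := by
    ext q; change A ((1 - ((1 : I) : ℝ)) * clamp01 (3 * q.1 - 1) + ((1 : I) : ℝ) * q.1, q.2) = A q
    rw [show ((1 : I) : ℝ) = 1 from rfl]; ring_nf
  have hins : ∀ (A₁ A₂ : C(ℝ × 𝕊¹, M)) (h₁ : ∀ u, A₁ (1, u) = X (bd u)) (h₂ : ∀ u, A₂ (1, u) = X (bd u)),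
      A₁ = A₂ → insertDisc A₁ X h₁ = insertDisc A₂ X h₂ := by
    intros A₁ A₂ h₁ h₂ e; subst e; rfl
  rw [← eClass_congr_disc (hins _ _ (hAs1 0) _ e0), ← eClass_congr_disc (hins _ _ (hAs1 1) hAX e1)]
  exact key

end Homotopy

end StableFrames

/-! ### 2. The core with one disc, and the drag -/

section Core

open StableFrames

variable {V : Type u} [TopologicalSpace V] [T2Space V] [SecondCountableTopology V] [CompactSpace V]
  [ChartedSpace (𝔼 4) V] [IsManifold (𝓡 4) ∞ V]
  {V' : Type u} [TopologicalSpace V'] [T2Space V'] [ChartedSpace (𝔼 4) V'] [IsManifold (𝓡 4) ∞ V']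

omit [SecondCountableTopology V] [CompactSpace V] [T2Space V'] [IsManifold (𝓡 4) ∞ V'] in
/-- Rewriting the circle of a tube along an equality of circles, keeping the classes. [folklore] -/
theorem CircleNbhd.exists_of_circle_eq_ob {e e' : 𝕊¹ → V} (heq : e = e') (ν : CircleNbhd (𝓡 4) e)
    (hν : IsOpenGluing (𝓡 4) (𝓘(ℝ, 𝔼 2).prod (𝓡 2)) (𝓡 4) (A := ν.complement) (B := ↥discTimesSphere) (P := V')
      (circleSurgeryRel ν)) :
    ∃ ν' : CircleNbhd (𝓡 4) e',
      IsOpenGluing (𝓡 4) (𝓘(ℝ, 𝔼 2).prod (𝓡 2)) (𝓡 4) (A := ν'.complement) (B := ↥discTimesSphere) (P := V')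
        (circleSurgeryRel ν') ∧ ∀ (D : C(𝔻², V)) (hD : ∀ u, D (bd u) = e' u) (hD' : ∀ u, D (bd u) = e u), ν'.ob D hD = ν.ob D hD' := by
  subst heq
  exact ⟨ν, hν, fun _ _ _ => rfl⟩

omit [SecondCountableTopology V] [CompactSpace V] [T2Space V'] in
/-- **The core with one disc**: a tube `μ` of the standard circle of a chart whose class relative
to the chart's flat disc is the universal class presents `V'` as `V # S² × S²` (the last part of
the proof of `isConnectedSum_of_forall_ob_eq`). [cite: Kirby1989, Ch. X p. 55] -/
theorem isConnectedSum_of_ob_flatDisc_eq (C : StdChart V) (μ : CircleNbhd (𝓡 4) C.c)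
    (hμ : IsOpenGluing (𝓡 4) (𝓘(ℝ, 𝔼 2).prod (𝓡 2)) (𝓡 4) (A := μ.complement) (B := ↥discTimesSphere) (P := V')
      (circleSurgeryRel μ))
    (hx : μ.ob C.flatDisc C.flatDisc_bd = rotClass two_le_four) :
    IsConnectedSum (𝓡 4) (𝓡 4) ((𝓡 2).prod (𝓡 2)) V ((sphere (0 : EuclideanSpace ℝ (Fin (2 + 1))) 1) ×
      (sphere (0 : EuclideanSpace ℝ (Fin (2 + 1))) 1)) V' := by
  haveI := Fact.mk (@finrank_euclideanSpace_fin ℝ _ 2)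
  obtain ⟨e₁⟩ := IsOpenGluing.nonempty_diffeomorph hμ μ.isOpenGluing_surgered
  obtain ⟨L, ⟨e₂⟩, hL⟩ := μ.exists_opLoop_surgered_and_ob C.nbhd
  have hcls : clsGL (CircleNbhd.nzLoop L) = 0 := by
    have h := hL C.flatDisc C.flatDisc_bd
    rw [hx, C.ob_nbhd_flatDisc] at h
    have : ∀ r x : ZMod 2, r = r + x → x = 0 := by decide
    exact this _ _ h
  obtain ⟨L', hL'pos, ⟨e₃⟩, hcls'⟩ : ∃ L' : OpLoop, 0 < LinearMap.det (L'.toFun ptA : 𝔼 3 →ₗ[ℝ] 𝔼 3) ∧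
      Nonempty ((C.nbhd.linTwist L).Surgered ≃ₘ⟮𝓡 4, 𝓡 4⟯ (C.nbhd.linTwist L').Surgered) ∧
        clsGL (CircleNbhd.nzLoop L') = 0 := by
    rcases (L.det_toFun_ne_zero ptA).lt_or_gt with hneg | hpos
    · refine ⟨L.mulReflect (spherePt 2), ?_, C.nbhd.nonempty_diffeomorph_surgered_linTwist_mulReflect _ L, ?_⟩
      · rw [OpLoop.det_mulReflect_toFun]; linarith
      · obtain ⟨R, hR⟩ := CircleNbhd.nzLoop_mulReflect L (spherePt 2)
        rw [hR, clsGL_mul (by norm_num), clsGL_const, add_zero, hcls]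
    · exact ⟨L, hpos, ⟨Diffeomorph.refl _ _ _⟩, hcls⟩
  have hdet : ∀ u, 0 < LinearMap.det (L'.toFun u : 𝔼 3 →ₗ[ℝ] 𝔼 3) := L'.det_pos_of_det_pos_ptA hL'pos
  have hcls₀ : cls (matLoop L' hdet) = 0 := by
    rw [← hcls']
    refine (clsGL_eq_cls_of_pos (CircleNbhd.nzLoop L') ?_ (matLoop L' hdet) fun u => rfl).symm
    change 0 < (toMat (L'.toFun u₀)).det
    rw [det_toMat]; exact hdet u₀
  obtain ⟨Fam, hFam, hFami, h0, h1⟩ := joined_one_of_cls_eq_zero hdet hcls₀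
  have h4 := C.nbhd.nonempty_diffeomorph_surgered_linTwist_of_family Fam hFam hFami
  rw [h0, h1, CircleNbhd.linTwist_one_eq] at h4
  obtain ⟨e₄⟩ := h4
  have hsum := C.isConnectedSum_of_isOpenGluing C.nbhd.isOpenGluing_surgered
  exact hsum.of_diffeomorph (e₁.trans (e₂.trans (e₃.trans e₄))).symm

omit [T2Space V'] in
/-- **A tube in a level containing an odd sphere gives a connected sum with `S² × S²`** (Kirby
1989, Ch. X p. 56 with Cor. I.4.6: *"it can be arranged for all 2-handles of W to be attached by
the trivial framing"* — drag the attaching circle around a 2-sphere on which `w₂ ≠ 0`).  For a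
simply connected closed smooth 4-manifold `V` containing a sphere map `h : S² → V` without stable
tangent framing, a smooth embedded circle `e` with tube `ν` and a presentation of `V'` as the
surgery of `V` along `ν`: `V'` is `V # (S² × S²)`.  Isotope `e` to the standard circle `γ` of a
chart (Milnor); if the class of the transported tube relative to the flat disc `D` is the universal
class, conclude by `isConnectedSum_of_ob_flatDisc_eq`; otherwise drag: the loop of circles
`dragLoop D h` (`CircleLoopDrag.lean`) is smoothed rel ends (`exists_contMDiff_homotopicRel_annulus`),
perturbed into a smooth isotopy of `γ` in the same homotopy class rel ends
(`exists_smoothIsotopy_homotopicRel`), extended to an ambient isotopy `Ψ` (Thm. 5.8,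
`exists_ambientIsotopy_comp_eq`); transporting the tube by `Ψ₁⁻¹` changes its class relative to
`D` to the class relative to `Ψ₁ ∘ D`, which by the drag identity is the class inserted by the
trace annulus, i.e. by `dragLoop D h`, i.e. the old class plus `1` (`eClass_insertDisc_dragLoop_ne`).
[cite: Kirby1989, Ch. X pp. 55–56, Cor. I.4.6] -/
theorem isConnectedSum_of_exists_odd [SimplyConnectedSpace V] {e : 𝕊¹ → V}
    (he : Manifold.IsSmoothEmbedding (𝓡 1) (𝓡 4) ∞ e) (ν : CircleNbhd (𝓡 4) e)
    (hν : IsOpenGluing (𝓡 4) (𝓘(ℝ, 𝔼 2).prod (𝓡 2)) (𝓡 4) (A := ν.complement) (B := ↥discTimesSphere) (P := V')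
      (circleSurgeryRel ν))
    (hodd : ∃ h : C(𝕊², V), ¬ HasStableTangentFramingAlong (𝓡 4) V h) :
    IsConnectedSum (𝓡 4) (𝓡 4) ((𝓡 2).prod (𝓡 2)) V ((sphere (0 : EuclideanSpace ℝ (Fin (2 + 1))) 1) ×
      (sphere (0 : EuclideanSpace ℝ (Fin (2 + 1))) 1)) V' := by
  haveI := Fact.mk (@finrank_euclideanSpace_fin ℝ _ 2)
  obtain ⟨g, hg⟩ := hodd
  -- a chart and the isotopy of `e` to its standard circle
  obtain ⟨C, -, -⟩ := StdChart.exists_mem_source (e ptA)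
  obtain ⟨F, hF⟩ := Milnor1965_isAmbientIsotopic_of_simplyConnected_holds (n := 4) le_rfl
    (inferInstance : SimplyConnectedSpace V) ⟨C.c, C.isSmoothEmbedding_c.isEmbedding.continuous⟩
    ⟨e, he.isEmbedding.continuous⟩ C.isSmoothEmbedding_c he
  set Φ := F.toDiffeomorph 1 with hΦ
  have hΦe : (Φ : V → V) ∘ e = C.c := by
    have h1 : (Φ : V → V) = F.toFun 1 := F.coe_toDiffeomorph 1
    rw [h1]; exact hF
  obtain ⟨μ, hμ, -⟩ := CircleNbhd.exists_of_circle_eq_ob hΦe (ν.map Φ) (ν.isOpenGluing_circleSurgeryRel_map hν Φ)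
  -- the class relative to the flat disc
  by_cases hx : μ.ob C.flatDisc C.flatDisc_bd = rotClass two_le_four
  · exact isConnectedSum_of_ob_flatDisc_eq C μ hμ hx
  -- ### the drag (`γ = C.c`, `D = C.flatDisc`)
  have hγs : Manifold.IsSmoothEmbedding (𝓡 1) (𝓡 4) ∞ C.c := C.isSmoothEmbedding_c
  have hγc : Continuous C.c := hγs.isEmbedding.continuous
  have hDbd : ∀ u, C.flatDisc (bd u) = C.c u := C.flatDisc_bd
  haveI : PathConnectedSpace V := inferInstance
  set p₀ : C(ℝ, V) := ⟨(PathConnectedSpace.somePath (C.flatDisc ctr) (discUp g ctr)).extend, Path.continuous_extend _⟩ with hp₀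
  set p : C(ℝ, V) := ⟨(PathConnectedSpace.somePath (discUp g ctr) (discDown g ctr)).extend, Path.continuous_extend _⟩ with hp
  have hp₀0 : p₀ 0 = C.flatDisc ctr := Path.extend_zero _
  have hp₀1 : p₀ 1 = discUp g ctr := Path.extend_one _
  have hp0 : p 0 = discUp g ctr := Path.extend_zero _
  have hp1 : p 1 = discDown g ctr := Path.extend_one _
  set A : C(ℝ × 𝕊¹, V) := dragLoop C.flatDisc g p₀ p hp₀0 hp₀1 hp0 hp1 with hA
  have hA0 : ∀ u, A (0, u) = C.c u := fun u => (dragLoop_zero C.flatDisc g p₀ p hp₀0 hp₀1 hp0 hp1 u).trans (hDbd u)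
  have hA1 : ∀ u, A (1, u) = C.c u := fun u => (dragLoop_one C.flatDisc g p₀ p hp₀0 hp₀1 hp0 hp1 u).trans (hDbd u)
  -- slow down, smooth rel ends, perturb to an isotopy, extend
  have hsl0 : ∀ t : ℝ, t ≤ 1 / 3 → ∀ u, slowA A (t, u) = C.c u := fun t ht u => (slowA_of_le A ht u).trans (hA0 u)
  have hsl1 : ∀ t : ℝ, 2 / 3 ≤ t → ∀ u, slowA A (t, u) = C.c u := fun t ht u => (slowA_of_ge A ht u).trans (hA1 u)
  obtain ⟨H, hHs, hH0, hH1, hHrel⟩ := exists_contMDiff_homotopicRel_annulus (n := 4) hγs.contMDiff (slowA A) hsl0 hsl1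
  obtain ⟨Fi, hFi⟩ := exists_smoothIsotopy_homotopicRel (n := 4) le_rfl hHs hγs hγs hH0 hH1
  obtain ⟨Ψ, hΨ⟩ := exists_ambientIsotopy_comp_eq Fi
  have hloopF : Ψ.toFun 1 ∘ C.c = Fi.toFun 1 := hΨ 1 ⟨zero_le_one, le_rfl⟩
  rw [Fi.map_one] at hloopF
  have hloop : ∀ u, Ψ.toFun 1 (C.c u) = C.c u := fun u => congrFun hloopF u
  set Ψd := Ψ.toDiffeomorph 1 with hΨd
  have hΨdγ : (Ψd : V → V) ∘ C.c = C.c := by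
    funext u; change (Ψ.toDiffeomorph 1 : V → V) (C.c u) = C.c u; rw [Ψ.coe_toDiffeomorph]; exact hloop u
  have hΨsγ : (Ψd.symm : V → V) ∘ C.c = C.c := by
    funext u
    have := congrFun hΨdγ u
    change Ψd.symm (C.c u) = C.c u
    conv_lhs => rw [← this]
    exact Ψd.symm_apply_apply _
  -- the transported tube and its class relative to the flat disc
  obtain ⟨μ₂, hμ₂, hob₂⟩ := CircleNbhd.exists_of_circle_eq_ob hΨsγ (μ.map Ψd.symm) (μ.isOpenGluing_circleSurgeryRel_map hμ Ψd.symm)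
  refine isConnectedSum_of_ob_flatDisc_eq C μ₂ hμ₂ ?_
  rw [hob₂ C.flatDisc C.flatDisc_bd (fun u => by rw [hΨsγ]; exact C.flatDisc_bd u), μ.ob_map_eq Ψd.symm]
  -- `ob(μ, Ψ₁ ∘ D)` by the drag identity
  have hcomp : compDisc ⟨Ψd.symm.symm, Ψd.symm.symm.continuous⟩ C.flatDisc = compDisc ⟨Ψ.toFun 1, (Ψ.contMDiff_toFun 1).continuous⟩ C.flatDisc := by
    ext x; change Ψd.symm.symm (C.flatDisc x) = Ψ.toFun 1 (C.flatDisc x); rw [← Ψ.coe_toDiffeomorph]; rfl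
  rw [μ.ob_congr_disc hcomp _ (fun u => by change Ψ.toFun 1 (C.flatDisc (bd u)) = C.c u; rw [hDbd, hloop]),
    μ.ob_compDisc_ambientIsotopy Ψ hγc hloop C.flatDisc hDbd]
  -- the trace annulus is the isotopy on `[0, 1]`
  have hFμ : IsStableFrameFieldOn C.c μ.tubeFr univ := μ.isStableFrameFieldOn_tubeFr
  set Fann : C(ℝ × 𝕊¹, V) := ⟨uncurry Fi.toFun, Fi.contMDiff.continuous⟩ with hFann
  have hFann1 : ∀ u, Fann (1, u) = C.flatDisc (bd u) := fun u => by
    change Fi.toFun 1 u = C.flatDisc (bd u); rw [Fi.map_one, hDbd]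
  have htr : ∀ t ∈ Icc (0 : ℝ) 1, ∀ u, traceAnnulus Ψ ⟨C.c, hγc⟩ (t, u) = Fann (t, u) := fun t ht u => by
    exact congrFun (hΨ t ht) u
  have e1 := eClass_congr_disc (insertDisc_congr_Icc htr (fun u => (hloop u).trans (hDbd u).symm) hFann1) (F := μ.tubeFr)
    (hFμ.congr_map fun u _ => by
      change insertDisc (traceAnnulus Ψ ⟨C.c, _⟩) C.flatDisc _ (bd u) = C.c u; rw [insertDisc_bd, traceAnnulus_zero]; rfl)
    (hFμ.congr_map fun u _ => by change insertDisc Fann C.flatDisc _ (bd u) = C.c u; rw [insertDisc_bd]; exact congrFun Fi.map_zero u)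
  -- the isotopy is homotopic rel ends to `H`, `H` to the slowed loop, which inserts the class of the loop
  have hS₀0 : ∀ u : 𝕊¹, (((0 : ℝ), u) : ℝ × 𝕊¹) ∈ {p : ℝ × 𝕊¹ | p.1 ∉ Ioo (1 / 8 : ℝ) (7 / 8)} := fun u h => by
    simp only [mem_Ioo] at h; linarith [h.1]
  have hS₀1 : ∀ u : 𝕊¹, (((1 : ℝ), u) : ℝ × 𝕊¹) ∈ {p : ℝ × 𝕊¹ | p.1 ∉ Ioo (1 / 8 : ℝ) (7 / 8)} := fun u h => by
    simp only [mem_Ioo] at h; linarith [h.2]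
  have hHann0 : ∀ u, (⟨H, hHs.continuous⟩ : C(ℝ × 𝕊¹, V)) (0, u) = C.c u := fun u => hH0 0 (by norm_num) u
  have hHann1 : ∀ u, (⟨H, hHs.continuous⟩ : C(ℝ × 𝕊¹, V)) (1, u) = C.flatDisc (bd u) := fun u => (hH1 1 (by norm_num) u).trans (hDbd u).symm
  have e2 := eClass_insertDisc_eq_of_homotopicRel (by norm_num) hFi hS₀0 hS₀1 hHann0 C.flatDisc hHann1 hFann1 hFμ
  have hS0 : ∀ u : 𝕊¹, (((0 : ℝ), u) : ℝ × 𝕊¹) ∈ {p : ℝ × 𝕊¹ | p.1 ≤ 1 / 4 ∨ 3 / 4 ≤ p.1} := fun u => Or.inl (by norm_num)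
  have hS1 : ∀ u : 𝕊¹, (((1 : ℝ), u) : ℝ × 𝕊¹) ∈ {p : ℝ × 𝕊¹ | p.1 ≤ 1 / 4 ∨ 3 / 4 ≤ p.1} := fun u => Or.inr (by norm_num)
  have hsl1' : ∀ u, slowA A (1, u) = C.flatDisc (bd u) := fun u => (hsl1 1 (by norm_num) u).trans (hDbd u).symm
  have e3 := eClass_insertDisc_eq_of_homotopicRel (by norm_num) hHrel hS0 hS1 (fun u => hsl0 0 (by norm_num) u) C.flatDisc hsl1' hHann1 hFμ
  have e4 := eClass_insertDisc_slowA (by norm_num) A hA0 C.flatDisc (fun u => (hA1 u).trans (hDbd u).symm) hFμ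
  have e5 := eClass_insertDisc_dragLoop_ne (by norm_num) C.flatDisc g p₀ p hp₀0 hp₀1 hp0 hp1 (hFμ.congr_map fun u _ => hDbd u) hg
  -- `ob(μ, D) ≠ rotClass`, and in `ZMod 2` the only other value is `rotClass + 1`
  have hxD : μ.ob C.flatDisc hDbd = eClass C.flatDisc μ.tubeFr (hFμ.congr_map fun u _ => hDbd u) := rfl
  have hx' : eClass C.flatDisc μ.tubeFr (hFμ.congr_map fun u _ => hDbd u) ≠ rotClass two_le_four := by rw [← hxD]; exact hx
  have eA : eClass (insertDisc A C.flatDisc fun u => (hA1 u).trans (hDbd u).symm) μ.tubeFr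
      (hFμ.congr_map fun u _ => by change insertDisc A C.flatDisc _ (bd u) = C.c u; rw [insertDisc_bd, hA0]) =
      eClass (insertDisc (dragLoop C.flatDisc g p₀ p hp₀0 hp₀1 hp0 hp1) C.flatDisc fun u => dragLoop_one C.flatDisc g p₀ p hp₀0 hp₀1 hp0 hp1 u) μ.tubeFr
        ((hFμ.congr_map fun u _ => hDbd u).congr_map fun u _ => by
          change insertDisc _ C.flatDisc _ (bd u) = C.flatDisc (bd u); rw [insertDisc_bd, dragLoop_zero]) := rfl
  have e14 := ((e1.trans e2.symm).trans e3.symm).trans e4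
  have fin : ∀ a d r : ZMod 2, a ≠ d → d ≠ r → a = r := by decide
  exact e14.trans (fin _ _ _ (eA ▸ e5) hx')

end Core

/-! ### 3. The level passage from an odd level -/

section Step

open StableFrames Cobordism

variable {X₁ X₂ : Type} [TopologicalSpace X₁] [T2Space X₁] [SecondCountableTopology X₁]
  [ChartedSpace (𝔼 4) X₁] [IsManifold (𝓡 4) ∞ X₁] [CompactSpace X₁] [SimplyConnectedSpace X₁]
  [TopologicalSpace X₂] [T2Space X₂] [SecondCountableTopology X₂]
  [ChartedSpace (𝔼 4) X₂] [IsManifold (𝓡 4) ∞ X₂] [CompactSpace X₂]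

/-- **The level passage across an index-2 critical point of an h-cobordism, from a level that
contains a sphere map without stable tangent framing, is a connected sum with `S² × S²`** (Kirby
1989, Ch. X p. 56: in the odd case *"it can be arranged for all 2-handles of W to be attached by
the trivial framing"*, Cor. I.4.6): Milnor's level-passing surgery along the left-hand circle
(`LevelPassageSurgery`) and `isConnectedSum_of_exists_odd`.
[cite: Kirby1989, Ch. X pp. 55–56, Cor. I.4.6] [cite: MilnorHCobordism1965, §3 p. 21, Thm. 3.13] -/
theorem Cobordism.IsHCobordism.isConnectedSum_levels_of_odd {c : Cobordism 4 X₁ X₂}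
    (hc : c.IsHCobordism) {g : c.W → ℝ} (hg : c.IsMorseFunction g)
    {q : c.W} (hq : q ∈ criticalSetOfIndex (𝓡∂ (4 + 1)) g 2)
    {b b₂ : ℝ} (hb : 0 < b) (hbq : b < g q) (hqb₂ : g q < b₂) (hb₂ : b₂ < 1)
    (honly : ∀ z ∈ criticalSet (𝓡∂ (4 + 1)) g, g z ∈ Icc b b₂ → z = q)
    (hidx : ∀ z ∈ criticalSet (𝓡∂ (4 + 1)) g, g z < b → morseIndex (𝓡∂ (4 + 1)) g z = 2)
    (V : Type) [TopologicalSpace V] [T2Space V] [ChartedSpace (𝔼 4) V] [IsManifold (𝓡 4) ∞ V]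
    (ι : V → c.W) (hι : Manifold.IsSmoothEmbedding (𝓡 4) (𝓡∂ (4 + 1)) ∞ ι) (hιr : range ι = g ⁻¹' {b})
    (hodd : ∃ h : C(𝕊², V), ¬ HasStableTangentFramingAlong (𝓡 4) V h)
    (V₂ : Type) [TopologicalSpace V₂] [T2Space V₂] [ChartedSpace (𝔼 4) V₂] [IsManifold (𝓡 4) ∞ V₂]
    (ι₂ : V₂ → c.W) (hι₂ : Manifold.IsSmoothEmbedding (𝓡 4) (𝓡∂ (4 + 1)) ∞ ι₂) (hι₂r : range ι₂ = g ⁻¹' {b₂}) :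
    IsConnectedSum (𝓡 4) (𝓡 4) ((𝓡 2).prod (𝓡 2)) V (𝕊² × 𝕊²) V₂ := by
  obtain ⟨ξ, hξ⟩ := Cobordism.Milnor1965_exists_isGradientLike_holds hg
  obtain ⟨P, hPq, hPb, hPb₂⟩ := hg.exists_passageSetting ξ hξ (k := 1) (by norm_num) hq hb hbq hqb₂ hb₂ honly
  subst hPq hPb hPb₂
  -- the two levels are nonempty
  haveI : Nonempty V := by
    have hz : g (Flow.levelProj P.θ g P.b (P.sphereMap Cobordism.LeftSphereSetting.basePoint)) = P.b :=
      Flow.apply_hittingTime (P.hits_b_of_apply_eq_b' (P.apply_sphereMap _))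
    have hz' : Flow.levelProj P.θ g P.b (P.sphereMap Cobordism.LeftSphereSetting.basePoint) ∈ range ι := by
      rw [hιr]; exact hz
    obtain ⟨v, -⟩ := hz'
    exact ⟨v⟩
  haveI : Nonempty V₂ := by
    have hz : (fun x => 1 - g x) (Flow.levelProj P.rev.θ (fun x => 1 - g x) P.rev.b
        (P.rev.sphereMap Cobordism.LeftSphereSetting.basePoint)) = P.rev.b :=
      Flow.apply_hittingTime (P.rev.hits_b_of_apply_eq_b' (P.rev.apply_sphereMap _))
    have hz' : Flow.levelProj P.rev.θ (fun x => 1 - g x) P.rev.b (P.rev.sphereMap Cobordism.LeftSphereSetting.basePoint) ∈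
        range ι₂ := by
      rw [P.range_eq_rev ι₂ hι₂r]; exact hz
    obtain ⟨v, -⟩ := hz'
    exact ⟨v⟩
  -- the lower level is a simply connected closed manifold
  have hreg : ∀ z ∈ criticalSet (𝓡∂ (4 + 1)) g, g z ≠ P.b := fun z hz hzb =>
    absurd (honly z hz ⟨hzb.ge, by rw [hzb]; linarith⟩) fun h => by rw [h] at hzb; linarith
  haveI : SimplyConnectedSpace V :=
    hc.simplyConnectedSpace_level_of_index_two hg hb (hbq.trans (hqb₂.trans hb₂)) hreg hidx V ι hι.isEmbedding hιr
  have hclosed : IsClosed (range ι) := by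
    rw [hιr]; exact (isClosed_singleton.preimage hg.isMorse.contMDiff.continuous)
  haveI : CompactSpace V :=
    ⟨hι.isEmbedding.isInducing.isCompact_iff.2 (by rw [image_univ]; exact hclosed.isCompact)⟩
  haveI : SecondCountableTopology V := hι.isEmbedding.secondCountableTopology
  -- the surgery presentation and the classes
  have hν := P.isOpenGluingWith_circleSurgeryRel ι hι hιr ι₂ hι₂ hι₂r
  exact isConnectedSum_of_exists_odd (P.isSmoothEmbedding_sphereEmb ι hι hιr) (P.circleNbhd ι hι hιr) ⟨_, _, hν⟩ hodd

end Step

end Literature.Topology.FourManifolds
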